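import Literature.Computability.Cryptography.UOWHFTreeHashReduction
import HarnessLib

/-!
# Tree hashing of a leveled halving family, IV: security (Goldreich 2004, Props. 6.4.25 and 6.4.27)

Topic `Literature/Computability/Cryptography`; continues `UOWHFTreeHash*.lean`. The designated-collision security of
the tree collection `treeHash S` (Def. 6.4.18, UNRESTRICTED collisions `x ≠ x₀`, `h_s̄(x) = h_s̄(x₀)`) reduces to the
restricted designated-collision security of the basic halving collection `base S` through the level-and-block planting
reduction `(B0PT, redBT)` of the previous file:

* transport: key coins as the code of `L` keys (`KC`, `KCL`), `keyAt_enc`, `splice_KCL` (splicing the challenge is updating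
  a key), `level_update_of_le` (levels up to `i` ignore key `i`);
* `LB i b` — "level-`i`, block-`b` collision" of the two-stage adversary under given keys; `LB_of_Acoll` (every designated
  collision whose target is in range and short is an `LB i b` for some `i < L`, `b < B_P`, by `exists_level_block_collision`);
  `collision_of_LB` (an `LB i b` under keys planted at `i`, with the codes of `(i, b)` in `B`'s coins, IS a restricted
  collision of `(B₀, B)` against the basic family);
* the counting bridge `tcrProb_tree_le`: at every parameter at which all targets are in range and short,
  `Pr[designated collision of treeHash S] ≤ 2^{|bin L| + |bin B_P|} · Pr[restricted designated collision of base S by (B₀, B)]`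
  (union bound over `(i, b)`, planting bijection `HHRVW.card_filter_plant`, codes);
* asymptotics: targets of a polynomial-time `A₀` are eventually in range (`L ≥ n` levels) and short, so negligibility
  transfers (`superpolynomialDecay_tcrProb_tree`), and `treeHash S` has negligible designated-collision probability for
  every two-stage PPT adversary whenever `base S` is a leveled restricted UOWHF (`tcr_treeHash`).

All statements proved; no named facts.

## References

* O. Goldreich, *Foundations of Cryptography II*, CUP 2004, §6.4.3.2, Props. 6.4.25, 6.4.27 (proofs), Def. 6.4.18.
* M. Naor, M. Yung, STOC 1989, §2 (tree hashing with universal one-way hash functions).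
-/

namespace Literature.Computability.Cryptography

namespace TreeHash

open _root_.Computability Complexity Complexity.BitCodec Complexity.Brick Polynomial Finset Filter Asymptotics
open HHRVW (fitLen length_fitLen fitLen_of_length_eq splice length_splice splice_append_left take_drop_append_left
  card_filter_plant ite_le_ite_of_imp)
open MDCompose (pShaped pShaped_index_run pShaped_hash nOf_length_idx length_index_pShaped ksOf ksOf_idx sum_ite_snd_eq)

/-! ### Codecs and transport -/

section Transport

variable (S : TSpec) (n : ℕ)

/-- Key coins of a basic index. [folklore] -/
abbrev Yv := List.Vector Bool (S.P.eval n)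

/-- The codec of the `L` keys. [folklore] -/
def KC : BitCodec (Fin (S.L n) → Yv S n) := (BitCodec.vector (S.P.eval n)).pi (S.L n)

/-- The unused coins of a tree index. [folklore] -/
def loLen : ℕ := S.pT.eval n - S.L n * S.P.eval n

/-- The codec of the tree index coins: keys and leftover. [folklore] -/
def KCL : BitCodec ((Fin (S.L n) → Yv S n) × List.Vector Bool (loLen S n)) := (KC S n).prod (BitCodec.vector (loLen S n))

variable {S n}

/-- Bookkeeping lemma (codec lengths). [folklore] -/
theorem KC_len : (KC S n).len = S.L n * S.P.eval n := by rw [KC, pi_len, vector_len]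

/-- Bookkeeping lemma (codec lengths). [folklore] -/
theorem KCL_len (hS : S.WF) : (KCL S n).len = S.pT.eval n := by
  rw [KCL, prod_len, KC_len, vector_len, loLen]; have := hS.pT_ge n; omega

/-- The `i`-th key block of a tree index is the code of key `i`. [folklore] -/
theorem keyAt_enc (keys : Fin (S.L n) → Yv S n) (lo : List.Vector Bool (loLen S n)) (i : Fin (S.L n)) :
    keyAt S n ((KCL S n).enc (keys, lo)) i = (keys i).toList := by
  have h := pi_enc_block (BitCodec.vector (S.P.eval n)) (S.L n) keys i
  rw [vector_len, vector_enc] at h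
  have hlen : ((KC S n).enc keys).length = S.L n * S.P.eval n := by rw [(KC S n).length_enc, KC_len]
  rw [KCL, prod_enc, vector_enc, keyAt, take_drop_append_left, KC, h]
  rw [hlen]
  have := Nat.mul_le_mul_right (S.P.eval n) (Nat.succ_le_of_lt i.isLt)
  rw [Nat.succ_mul] at this; exact this

/-- The `i`-th basic index of a tree index. [folklore] -/
theorem idxAt_enc (keys : Fin (S.L n) → Yv S n) (lo : List.Vector Bool (loLen S n)) (i : Fin (S.L n)) :
    idxAt S n ((KCL S n).enc (keys, lo)) i = ones n ++ false :: (keys i).toList := by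
  rw [idxAt, keyAt_enc]

/-- The key coins are long enough. [folklore] -/
theorem le_length_enc (keys : Fin (S.L n) → Yv S n) (lo : List.Vector Bool (loLen S n)) :
    S.L n * S.P.eval n ≤ ((KCL S n).enc (keys, lo)).length := by
  rw [(KCL S n).length_enc, KCL, prod_len, KC_len, vector_len]; omega

/-- **Splicing the challenge into block `i` is updating key `i`.** [folklore] -/
theorem splice_KCL (i : Fin (S.L n)) (y : Yv S n) (keys : Fin (S.L n) → Yv S n) (lo : List.Vector Bool (loLen S n)) :
    splice (S.P.eval n) i y.toList ((KCL S n).enc (keys, lo)) = (KCL S n).enc (Function.update keys i y, lo) := by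
  have hlen : ((KC S n).enc keys).length = S.L n * S.P.eval n := by rw [(KC S n).length_enc, KC_len]
  have hb : ((i : ℕ) + 1) * S.P.eval n ≤ ((KC S n).enc keys).length := by rw [hlen]; exact Nat.mul_le_mul_right _ i.isLt
  have hu := BitCodec.pi_enc_update (BitCodec.vector (S.P.eval n)) (S.L n) keys i y
  rw [vector_len, vector_enc] at hu
  rw [KCL, prod_enc, prod_enc, vector_enc, splice_append_left hb, KC, hu]

/-- Levels depend only on the keys below them. [folklore] -/
theorem level_congr {kb kb' : List Bool} (x : List Bool) :
    ∀ {i : ℕ}, (∀ j, j < i → keyAt S n kb j = keyAt S n kb' j) → level S n kb x i = level S n kb' x i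
  | 0, _ => rfl
  | i + 1, h => by
    show blockwise S n (keyAt S n kb i) (level S n kb x i) = blockwise S n (keyAt S n kb' i) (level S n kb' x i)
    rw [level_congr x (fun j hj => h j (by omega)), h i (by omega)]

/-- **Updating key `i` is invisible up to level `i`.** [folklore] -/
theorem level_update_of_le (i : Fin (S.L n)) (y : Yv S n) (keys : Fin (S.L n) → Yv S n) (lo : List.Vector Bool (loLen S n))
    (x : List Bool) {j : ℕ} (hj : j ≤ i) :
    level S n ((KCL S n).enc (Function.update keys i y, lo)) x j = level S n ((KCL S n).enc (keys, lo)) x j :=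
  level_congr x fun k hk => by
    have hk' : k < S.L n := lt_of_lt_of_le hk (hj.trans i.isLt.le)
    rw [show k = ((⟨k, hk'⟩ : Fin (S.L n)) : ℕ) from rfl, keyAt_enc, keyAt_enc, Function.update_of_ne]
    intro h
    have := congrArg Fin.val h
    simp only at this
    omega

/-- Length of a block of a string of `k` blocks. [folklore] -/
theorem length_blk {z : List Bool} {k : ℕ} (hz : z.length = k * (2 * S.m n)) {b : ℕ} (hb : b < k) : (blk S n z b).length = 2 * S.m n := by
  rw [blk, List.length_take, List.length_drop, hz, min_eq_left]
  have := Nat.mul_le_mul_right (2 * S.m n) (Nat.succ_le_of_lt hb); rw [Nat.succ_mul] at this; omega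

end Transport

/-! ### The two-stage adversary at one level, and level-block collisions -/

section Adversary

variable (S : TSpec) (n qn κ : ℕ) (A₀ : List Bool → List Bool) (A : RandAlg (List Bool) (List Bool))

/-- The target `x₀ = A₀(ρ)`. [folklore] -/
def x0v (ρ : List.Vector Bool qn) : List Bool := A₀ ρ.toList

/-- `A`'s answer under keys `keys` (and leftover `lo`), coins `ρ`, `ω`. [folklore] -/
def xav (keys : Fin (S.L n) → Yv S n) (c : List.Vector Bool qn × List.Vector Bool (loLen S n)) (ω : List.Vector Bool κ) : List Bool :=
  A.run (boolPair (unaryEncodeNat n) (boolPair (ones n ++ false :: (KCL S n).enc (keys, c.2)) c.1.toList)) ω.toList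

/-- **A designated collision of the tree** by `(A₀, A)` at `(keys, (ρ, lo), ω)`. [cite: Goldreich2004, Def. 6.4.18] -/
def Acoll (z : (Fin (S.L n) → Yv S n) × (List.Vector Bool qn × List.Vector Bool (loLen S n)) × List.Vector Bool κ) : Prop :=
  treeOut S n ((KCL S n).enc (z.1, z.2.1.2)) (xav S n qn κ A z.1 z.2.1 z.2.2) = treeOut S n ((KCL S n).enc (z.1, z.2.1.2)) (x0v qn A₀ z.2.1.1) ∧
    xav S n qn κ A z.1 z.2.1 z.2.2 ≠ x0v qn A₀ z.2.1.1

/-- **A level-`i`, block-`b` collision**: the target is in range, `i` is below its depth, `b` is a block of level `i`,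
the tree hashes agree, and the level-`i` strings of target and answer differ at block `b` while the key-`i` function
merges the two blocks. [cite: Goldreich2004, proofs of Props. 6.4.25 and 6.4.27] -/
def LB (i b : ℕ) (z : (Fin (S.L n) → Yv S n) × (List.Vector Bool qn × List.Vector Bool (loLen S n)) × List.Vector Bool κ) : Prop :=
  dep S n (x0v qn A₀ z.2.1.1) ≤ S.L n ∧ i < dep S n (x0v qn A₀ z.2.1.1) ∧ b < 2 ^ (dep S n (x0v qn A₀ z.2.1.1) - (i + 1)) ∧
    treeOut S n ((KCL S n).enc (z.1, z.2.1.2)) (xav S n qn κ A z.1 z.2.1 z.2.2) = treeOut S n ((KCL S n).enc (z.1, z.2.1.2)) (x0v qn A₀ z.2.1.1) ∧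
    blk S n (level S n ((KCL S n).enc (z.1, z.2.1.2)) (x0v qn A₀ z.2.1.1) i) b ≠
      blk S n (level S n ((KCL S n).enc (z.1, z.2.1.2)) (xav S n qn κ A z.1 z.2.1 z.2.2) i) b ∧
    S.hb (boolPair (idxAt S n ((KCL S n).enc (z.1, z.2.1.2)) i) (blk S n (level S n ((KCL S n).enc (z.1, z.2.1.2)) (x0v qn A₀ z.2.1.1) i) b)) =
      S.hb (boolPair (idxAt S n ((KCL S n).enc (z.1, z.2.1.2)) i) (blk S n (level S n ((KCL S n).enc (z.1, z.2.1.2)) (xav S n qn κ A z.1 z.2.1 z.2.2) i) b))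

variable {S n qn κ A₀ A}

/-- **Every designated collision with an in-range, short target is a level-block collision** with `i < L`, `b < B`.
[cite: Goldreich2004, proofs of Props. 6.4.25, 6.4.27] -/
theorem LB_of_Acoll (hS : S.WF) {Bn : ℕ} {z : (Fin (S.L n) → Yv S n) × (List.Vector Bool qn × List.Vector Bool (loLen S n)) × List.Vector Bool κ}
    (hdep : dep S n (x0v qn A₀ z.2.1.1) ≤ S.L n) (hlen : (x0v qn A₀ z.2.1.1).length + 1 ≤ Bn) (h : Acoll S n qn κ A₀ A z) :
    ∃ i : Fin (S.L n), ∃ b : Fin Bn, LB S n qn κ A₀ A i b z := by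
  have hm := hS.one_le_m n
  obtain ⟨i, hi, j, hj, hne, heq⟩ := exists_level_block_collision hS (le_length_enc z.1 z.2.1.2) hdep (Ne.symm h.2) h.1.symm
  have hiL : i < S.L n := lt_of_lt_of_le hi hdep
  -- `j < 2^{t-i-1} ≤ 2^{t-1} ≤ m·2^{t-1} ≤ |x₀| < Bn`
  have h1 : 2 ^ (dep S n (x0v qn A₀ z.2.1.1) - (i + 1)) ≤ 2 ^ (dep S n (x0v qn A₀ z.2.1.1) - 1) := Nat.pow_le_pow_right (by norm_num) (by omega)
  have h2 : S.m n * 2 ^ (dep S n (x0v qn A₀ z.2.1.1) - 1) < (x0v qn A₀ z.2.1.1).length + 1 :=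
    lt_of_lt_depth hm (t := dep S n (x0v qn A₀ z.2.1.1) - 1) (by show dep S n (x0v qn A₀ z.2.1.1) - 1 < dep S n (x0v qn A₀ z.2.1.1); omega)
  have h3 : 2 ^ (dep S n (x0v qn A₀ z.2.1.1) - 1) ≤ S.m n * 2 ^ (dep S n (x0v qn A₀ z.2.1.1) - 1) := Nat.le_mul_of_pos_left _ hm
  exact ⟨⟨i, hiL⟩, ⟨j, by omega⟩, hdep, hi, hj, h.1, hne, heq⟩

end Adversary

/-! ### The coins of `B` and the planted implication -/

section PlantB

variable (S : TSpec) (q BP : Polynomial ℕ) (n : ℕ)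

/-- The unused coins of `B`. [folklore] -/
noncomputable def jkLen : ℕ := LenPres.M (QB S q BP) n - (aLb S n + aBb BP n + q.eval n + S.pT.eval n)

/-- The payload of `B`'s coins after the two guess fields: `ρ`, keys and leftover, junk. [folklore] -/
noncomputable def RestC : BitCodec (List.Vector Bool (q.eval n) × (((Fin (S.L n) → Yv S n) × List.Vector Bool (loLen S n)) × List.Vector Bool (jkLen S q BP n))) :=
  (BitCodec.vector (q.eval n)).prod ((KCL S n).prod (BitCodec.vector (jkLen S q BP n)))

/-- **The codec of `B`'s coins** `r_B = ⟨i⟩ ++ ⟨b⟩ ++ ρ ++ kb ++ junk`. [folklore] -/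
noncomputable def RBC : BitCodec ((List.Vector Bool (aLb S n) × List.Vector Bool (aBb BP n)) ×
    (List.Vector Bool (q.eval n) × (((Fin (S.L n) → Yv S n) × List.Vector Bool (loLen S n)) × List.Vector Bool (jkLen S q BP n)))) :=
  ((BitCodec.vector (aLb S n)).prod (BitCodec.vector (aBb BP n))).prod (RestC S q BP n)

/-- The level code of `i`. [folklore] -/
def ibOf (i : Fin (S.L n)) : List.Vector Bool (aLb S n) := ⟨Complexity.natBits (aLb S n) i, Complexity.length_natBits _ _⟩

/-- The block code of `b`. [folklore] -/
def bbOf (b : Fin (BP.eval n)) : List.Vector Bool (aBb BP n) := ⟨Complexity.natBits (aBb BP n) b, Complexity.length_natBits _ _⟩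

variable {S q BP n}

/-- Bookkeeping lemma (codec lengths). [folklore] -/
theorem RestC_len (hS : S.WF) : (RestC S q BP n).len = q.eval n + S.pT.eval n + jkLen S q BP n := by
  rw [RestC, prod_len, prod_len, vector_len, vector_len, KCL_len hS]; ring

/-- Bookkeeping lemma (codec lengths). [folklore] -/
theorem RBC_len (hS : S.WF) : (RBC S q BP n).len = LenPres.M (QB S q BP) n := by
  rw [RBC, prod_len, prod_len, vector_len, vector_len, RestC_len hS, jkLen]
  have := fields_le (q := q) (BP := BP) hS n; omega

/-- Decoding the level code. [folklore] -/
theorem bitsToNat_ibOf (i : Fin (S.L n)) : bitsToNat (ibOf S n i).toList = i := by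
  have hL : S.L n < 2 ^ aLb S n := by rw [aLb]; simpa using bitsToNat_lt (encodeNat (S.L n))
  exact Complexity.bitsToNat_natBits (lt_trans i.isLt hL)

/-- Decoding the block code. [folklore] -/
theorem bitsToNat_bbOf (b : Fin (BP.eval n)) : bitsToNat (bbOf BP n b).toList = b := by
  have hB : BP.eval n < 2 ^ aBb BP n := by rw [aBb]; simpa using bitsToNat_lt (encodeNat (BP.eval n))
  exact Complexity.bitsToNat_natBits (lt_trans b.isLt hB)

/-- `ibOf` is injective. [folklore] -/
theorem ibOf_injective : Function.Injective (ibOf S n) := fun i i' h => by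
  apply Fin.ext; rw [← bitsToNat_ibOf i, h, bitsToNat_ibOf]

/-- `bbOf` is injective. [folklore] -/
theorem bbOf_injective : Function.Injective (bbOf BP n) := fun b b' h => by
  apply Fin.ext; rw [← bitsToNat_bbOf b, h, bitsToNat_bbOf]

variable (ib : List.Vector Bool (aLb S n)) (bb : List.Vector Bool (aBb BP n)) (ρ : List.Vector Bool (q.eval n))
  (kl : (Fin (S.L n) → Yv S n) × List.Vector Bool (loLen S n)) (jk : List.Vector Bool (jkLen S q BP n))

/-- The fields of coded coins: the level. [folklore] -/
theorem iOf_RBC : iOf S n ((RBC S q BP n).enc ((ib, bb), ρ, kl, jk)) = min (bitsToNat ib.toList) (S.L n - 1) := by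
  rw [iOf, RBC, prod_enc, prod_enc, vector_enc, vector_enc, List.append_assoc, List.take_left' ib.toList_length]

/-- The fields of coded coins: the block. [folklore] -/
theorem bOf_RBC : bOf S BP n ((RBC S q BP n).enc ((ib, bb), ρ, kl, jk)) = bitsToNat bb.toList := by
  rw [bOf, RBC, prod_enc, prod_enc, vector_enc, vector_enc, List.append_assoc, List.drop_left' ib.toList_length, List.take_left' bb.toList_length]

/-- The fields of coded coins: `ρ`. [folklore] -/
theorem ρOf_RBC : ρOf S q BP n ((RBC S q BP n).enc ((ib, bb), ρ, kl, jk)) = ρ.toList := by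
  rw [ρOf, RBC, prod_enc, prod_enc, vector_enc, vector_enc, List.append_assoc, ← List.drop_drop, List.drop_left' ib.toList_length,
    List.drop_left' bb.toList_length, RestC, prod_enc, vector_enc, List.take_left' ρ.toList_length]

/-- The fields of coded coins: the key coins. [folklore] -/
theorem kbOf_RBC (hS : S.WF) : kbOf S q BP n ((RBC S q BP n).enc ((ib, bb), ρ, kl, jk)) = (KCL S n).enc kl := by
  rw [kbOf, RBC, prod_enc, prod_enc, vector_enc, vector_enc, List.append_assoc, ← List.drop_drop, ← List.drop_drop, List.drop_left' ib.toList_length,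
    List.drop_left' bb.toList_length, RestC, prod_enc, vector_enc, List.drop_left' ρ.toList_length, prod_enc,
    List.take_left' (by rw [(KCL S n).length_enc, KCL_len hS])]

/-- The length of coded coins. [folklore] -/
theorem length_RBC_enc (hS : S.WF) : ((RBC S q BP n).enc ((ib, bb), ρ, kl, jk)).length = LenPres.M (QB S q BP) n := by
  rw [(RBC S q BP n).length_enc, RBC_len hS]

/-- The basic hash is the brick on the pair. [folklore] -/
theorem base_hash (s x : List Bool) : (base S).hash s x = S.hb (boolPair s x) := rfl

/-- Assembling a restricted designated collision from its four conditions. [cite: Goldreich2004, Def. 6.4.19] -/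
theorem isRestrictedCollision_intro {H : HashCollection} {d : ℕ → ℕ} {s x₀ x : List Bool} (h1 : x₀.length = d s.length)
    (h2 : x.length = d s.length) (h3 : H.hash s x = H.hash s x₀) (h4 : x ≠ x₀) : H.IsRestrictedCollision d (s, x₀, x) :=
  ⟨h1, h2, h3, h4⟩

variable {A₀ : List Bool → List Bool} {A : RandAlg (List Bool) (List Bool)} {κ : ℕ}

/-- **A level-`i`, block-`b` collision under keys planted at `i`, with the codes of `(i, b)` in `B`'s coins, is a
restricted designated collision of `(B₀, B)` against the basic family.** [cite: Goldreich2004, proofs of Props. 6.4.25, 6.4.27] -/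
theorem collision_of_LB (hS : S.WF) (hL : 1 ≤ S.L n) {dB : ℕ → ℕ} (hdB : dB (LenPres.M S.P n) = 2 * S.m n)
    (i : Fin (S.L n)) (b : Fin (BP.eval n)) (y : Yv S n) (keys : Fin (S.L n) → Yv S n) (lo : List.Vector Bool (loLen S n))
    (ρ : List.Vector Bool (q.eval n)) (jk : List.Vector Bool (jkLen S q BP n)) (ω : List.Vector Bool κ)
    (hLB : LB S n (q.eval n) κ A₀ A i b (Function.update keys i y, (ρ, lo), ω)) :
    (base S).IsRestrictedCollision dB (ones n ++ false :: y.toList,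
      B0PT S q BP A₀ ((RBC S q BP n).enc ((ibOf S n i, bbOf BP n b), ρ, (keys, lo), jk)),
      (redBT S q BP A).run (boolPair (unaryEncodeNat n) (boolPair (ones n ++ false :: y.toList)
        ((RBC S q BP n).enc ((ibOf S n i, bbOf BP n b), ρ, (keys, lo), jk)))) ω.toList) := by
  -- names
  obtain ⟨rB, hrBdef⟩ : ∃ rB, rB = (RBC S q BP n).enc ((ibOf S n i, bbOf BP n b), ρ, (keys, lo), jk) := ⟨_, rfl⟩
  obtain ⟨keys', hkeys'⟩ : ∃ k, k = Function.update keys i y := ⟨_, rfl⟩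
  obtain ⟨x0, hx0⟩ : ∃ x, x = A₀ ρ.toList := ⟨_, rfl⟩
  obtain ⟨xa, hxa⟩ : ∃ x, x = xav S n (q.eval n) κ A keys' (ρ, lo) ω := ⟨_, rfl⟩
  obtain ⟨kb', hkb'⟩ : ∃ k, k = (KCL S n).enc (keys', lo) := ⟨_, rfl⟩
  rw [← hrBdef]; rw [← hkeys'] at hLB
  obtain ⟨hdep0, hi, hb2, htree, hne, heq⟩ := hLB
  rw [x0v, ← hx0] at hdep0 hi hb2 htree hne heq
  rw [← hxa, ← hkb'] at htree hne heq
  have hrB : rB.length = LenPres.M (QB S q BP) n := by rw [hrBdef]; exact length_RBC_enc _ _ _ _ _ hS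
  have hiOf : iOf S n rB = i := by
    rw [hrBdef, iOf_RBC, bitsToNat_ibOf, min_eq_left]; have := i.isLt; omega
  have hbOf : bOf S BP n rB = b := by rw [hrBdef, bOf_RBC, bitsToNat_bbOf]
  have hρ : ρOf S q BP n rB = ρ.toList := by rw [hrBdef, ρOf_RBC]
  have hkb : kbOf S q BP n rB = (KCL S n).enc (keys, lo) := by rw [hrBdef, kbOf_RBC _ _ _ _ _ hS]
  have hkbL : S.L n * S.P.eval n ≤ kb'.length := by rw [hkb']; exact le_length_enc _ _
  -- the answer is in range, at the same depth
  obtain ⟨hdepa, hdeq, -⟩ := treeOut_eq_treeOut (kb := kb') hdep0 htree.symm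
  -- the first stage
  have hB0 : B0PT S q BP A₀ rB = blk S n (level S n kb' x0 i) b := by
    rw [B0PT_apply hS hrB (by rw [hρ, ← hx0]; exact hdep0) (by rw [hρ, ← hx0, hiOf]; exact hi.le), B0fun, hrB, nOf_QB, tgt, hkb, hρ, ← hx0,
      hiOf, hbOf, hkb', hkeys', level_update_of_le i y keys lo x0 le_rfl]
  -- the spliced keys are the updated keys
  have hkbS : kbS S q BP n (ones n ++ false :: y.toList) rB = kb' := by
    rw [kbS, hiOf, ksOf_idx, hkb, splice_KCL, hkb', hkeys']
  have hxA : xA S q BP A n (ones n ++ false :: y.toList) rB ω.toList = xa := by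
    rw [xA, sbar, hkbS, hρ, hxa, xav, hkb']
  -- the second stage
  have hB : (redBT S q BP A).run (boolPair (unaryEncodeNat n) (boolPair (ones n ++ false :: y.toList) rB)) ω.toList = blk S n (level S n kb' xa i) b := by
    rw [redBT_run hS hL hrB (by rw [ksOf_idx, y.toList_length]) (by rw [hxA]; exact hdepa) (by rw [hxA, hiOf, ← hdeq]; exact hi.le), outB, hkbS, hxA,
      hiOf, hbOf]
  -- lengths of the two blocks
  have hlen0 : (level S n kb' x0 i).length = 2 ^ (dep S n x0 - (i + 1)) * (2 * S.m n) := by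
    rw [length_level hS hkbL hdep0 hi.le, show dep S n x0 - i = dep S n x0 - (i + 1) + 1 by omega, pow_succ]; ring
  have hlena : (level S n kb' xa i).length = 2 ^ (dep S n x0 - (i + 1)) * (2 * S.m n) := by
    rw [length_level hS hkbL hdepa (by rw [← hdeq]; exact hi.le), ← hdeq, show dep S n x0 - i = dep S n x0 - (i + 1) + 1 by omega, pow_succ]; ring
  have hsL : (ones n ++ false :: y.toList).length = LenPres.M S.P n := by simp [ones, LenPres.M]; ring
  have hidx : idxAt S n kb' i = ones n ++ false :: y.toList := by rw [hkb', idxAt_enc, hkeys', Function.update_self]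
  rw [hB, hB0]
  refine isRestrictedCollision_intro ?_ ?_ ?_ (Ne.symm hne)
  · rw [length_blk hlen0 hb2, hsL, hdB]
  · rw [length_blk hlena hb2, hsL, hdB]
  · rw [base_hash, base_hash, ← hidx, heq]

end PlantB

/-! ### The counting bridge -/

section Count

variable {S : TSpec} {q BP : Polynomial ℕ} {A₀ : List Bool → List Bool} {A : RandAlg (List Bool) (List Bool)}

/-- `QB(n) ≥ …`: the value `M_Q(n)` is what `B₀` reads off. [folklore] -/
theorem QB_eval_eq (n : ℕ) : (QB S q BP + Polynomial.X + 1).eval n = LenPres.M (QB S q BP) n := by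
  simp [LenPres.M]

/-- Re-indexing `B`'s success tuples: `(((ρ, (kl, jk)), y), ω) ↦ (jk, (y, kl.1, (ρ, kl.2), ω))`. [folklore] -/
def reixT (S : TSpec) (q BP : Polynomial ℕ) (n κ : ℕ) :
    ((List.Vector Bool (q.eval n) × (((Fin (S.L n) → Yv S n) × List.Vector Bool (loLen S n)) × List.Vector Bool (jkLen S q BP n))) ×
        Yv S n) × List.Vector Bool κ ≃
      List.Vector Bool (jkLen S q BP n) × (Yv S n × (Fin (S.L n) → Yv S n) × (List.Vector Bool (q.eval n) × List.Vector Bool (loLen S n)) × List.Vector Bool κ) where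
  toFun := fun ⟨⟨⟨ρ, ⟨keys, lo⟩, jk⟩, y⟩, ω⟩ => (jk, (y, keys, (ρ, lo), ω))
  invFun := fun ⟨jk, y, keys, ⟨ρ, lo⟩, ω⟩ => (((ρ, (keys, lo), jk), y), ω)
  left_inv := fun ⟨⟨⟨_, ⟨_, _⟩, _⟩, _⟩, _⟩ => rfl
  right_inv := fun ⟨_, _, _, ⟨_, _⟩, _⟩ => rfl

/-- **The counting bridge** (Props. 6.4.25/6.4.27, quantitatively): at every parameter at which `L ≥ 1` and every target of
`A₀` is in range and shorter than `B_P`, `Pr[designated collision of treeHash S by (A₀, A)] ≤ 2^{|bin L| + |bin B_P|} ·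
Pr[restricted designated collision of base S by (B₀, B)]`. [cite: Goldreich2004, proofs of Props. 6.4.25, 6.4.27] -/
theorem tcrProb_tree_le (hS : S.WF) {dB : ℕ → ℕ} (hdB : ∀ n, dB (LenPres.M S.P n) = 2 * S.m n) (n : ℕ) (hL : 1 ≤ S.L n)
    (hgood : ∀ r : List Bool, r.length = q.eval n → dep S n (A₀ r) ≤ S.L n ∧ (A₀ r).length + 1 ≤ BP.eval n) :
    (treeHash S).tcrProb (fun m => q.eval m) A₀ A n ≤
      2 ^ (aLb S n + aBb BP n) * (base S).rtcrProb dB (fun m => (QB S q BP + Polynomial.X + 1).eval m) (B0PT S q BP A₀) (redBT S q BP A) n := by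
  classical
  -- names for the sizes
  set κ := A.coinLen (lenA2 S q n) with hκ
  -- Step 1: the tree probability as a normalised count over `(ρ, ys, ω)`
  let IS : List.Vector Bool (q.eval n) → List.Vector Bool (KCL S n).len → List.Vector Bool κ → ℝ := fun ρ ys ω =>
    if (treeHash S).hash ((treeHash S).index.run n ys.toList) (A.run (boolPair (unaryEncodeNat n) (boolPair ((treeHash S).index.run n ys.toList) ρ.toList)) ω.toList) =
          (treeHash S).hash ((treeHash S).index.run n ys.toList) (A₀ ρ.toList) ∧
        A.run (boolPair (unaryEncodeNat n) (boolPair ((treeHash S).index.run n ys.toList) ρ.toList)) ω.toList ≠ A₀ ρ.toList then 1 else 0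
  have hrun2 : ∀ ys : List.Vector Bool (KCL S n).len, (treeHash S).index.run n ys.toList = ones n ++ false :: ys.toList :=
    fun ys => pShaped_index_run _ _ _ _
  have hlenA : ∀ (ρ : List.Vector Bool (q.eval n)) (ys : List.Vector Bool (KCL S n).len),
      (boolPair (unaryEncodeNat n) (boolPair ((treeHash S).index.run n ys.toList) ρ.toList)).length = lenA2 S q n := by
    intro ρ ys
    simp only [lenA2, length_boolPair, hrun2, ones, List.length_append, List.length_replicate, List.length_cons,
      List.Vector.toList_length, KCL_len hS, LenPres.M]; ring
  have hmid : (treeHash S).index.coinLen (unaryEncodeNat n).length = (KCL S n).len := by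
    rw [treeHash_index_coinLen, unaryEncodeNat_eq_replicate, List.length_replicate, KCL_len hS]
  have h1 : (treeHash S).tcrProb (fun m => q.eval m) A₀ A n =
      (∑ ρ : List.Vector Bool (q.eval n), ∑ ys : List.Vector Bool (KCL S n).len, ∑ ω : List.Vector Bool κ, IS ρ ys ω) /
        (2 ^ q.eval n * 2 ^ (KCL S n).len * 2 ^ κ) := by
    rw [HashCollection.tcrProb_eq_uniformAvg, hmid, uniformAvg]
    have hρ : ∀ ρ : List.Vector Bool (q.eval n), uniformAvg (KCL S n).len (fun rI => uniformAvg
        (A.coinLen (boolPair (unaryEncodeNat n) (boolPair ((treeHash S).index.run n rI) ρ.toList)).length)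
        (fun rA => if (treeHash S).hash ((treeHash S).index.run n rI) (A.run (boolPair (unaryEncodeNat n) (boolPair ((treeHash S).index.run n rI) ρ.toList)) rA) =
            (treeHash S).hash ((treeHash S).index.run n rI) (A₀ ρ.toList) ∧
          A.run (boolPair (unaryEncodeNat n) (boolPair ((treeHash S).index.run n rI) ρ.toList)) rA ≠ A₀ ρ.toList
          then (1 : ℝ) else 0)) = (∑ ys : List.Vector Bool (KCL S n).len, (∑ ω : List.Vector Bool κ, IS ρ ys ω) / 2 ^ κ) / 2 ^ (KCL S n).len := by
      intro ρ
      rw [uniformAvg, Finset.sum_congr rfl fun ys _ => by rw [hlenA ρ ys, ← hκ, uniformAvg]]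
    rw [Finset.sum_congr rfl fun ρ _ => hρ ρ]
    simp only [← Finset.sum_div]
    rw [div_div, div_div]
    refine congrArg₂ (· / ·) rfl ?_
    ring
  -- Step 2: the indicator is the collision predicate on decoded keys
  let E : (Fin (S.L n) → Yv S n) × (List.Vector Bool (q.eval n) × List.Vector Bool (loLen S n)) × List.Vector Bool κ → Prop :=
    fun z => Acoll S n (q.eval n) κ A₀ A z
  have h2 : ∀ (ρ : List.Vector Bool (q.eval n)) (ys : List.Vector Bool (KCL S n).len) (ω : List.Vector Bool κ), IS ρ ys ω ≤
      (if E (((KCL S n).dec ys.toList).1, (ρ, ((KCL S n).dec ys.toList).2), ω) then 1 else 0) := by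
    intro ρ ys ω
    refine ite_le_ite_of_imp fun hc => ?_
    have hsplit : (KCL S n).enc ((KCL S n).dec ys.toList) = ys.toList := (KCL S n).enc_dec ys.toList (List.Vector.toList_length ys)
    have hys : ys.toList.length = S.pT.eval n := by rw [List.Vector.toList_length, KCL_len hS]
    rw [hrun2, treeHash_hash_eq hS hys, treeHash_hash_eq hS hys] at hc
    show treeOut S n _ _ = treeOut S n _ _ ∧ _ ≠ _
    rw [xav, x0v, Prod.mk.eta, hsplit]
    exact hc
  -- Step 3: the count `C₀` of collisions
  let C₀ := ((univ : Finset ((Fin (S.L n) → Yv S n) × (List.Vector Bool (q.eval n) × List.Vector Bool (loLen S n)) × List.Vector Bool κ)).filter E).card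
  have h3 : ∑ ρ : List.Vector Bool (q.eval n), ∑ ys : List.Vector Bool (KCL S n).len, ∑ ω : List.Vector Bool κ, IS ρ ys ω ≤ C₀ := by
    calc ∑ ρ : List.Vector Bool (q.eval n), ∑ ys : List.Vector Bool (KCL S n).len, ∑ ω : List.Vector Bool κ, IS ρ ys ω
        ≤ ∑ ρ : List.Vector Bool (q.eval n), ∑ ys : List.Vector Bool (KCL S n).len, ∑ ω : List.Vector Bool κ,
            (if E (((KCL S n).dec ys.toList).1, (ρ, ((KCL S n).dec ys.toList).2), ω) then (1 : ℝ) else 0) :=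
          Finset.sum_le_sum fun ρ _ => Finset.sum_le_sum fun ys _ => Finset.sum_le_sum fun ω _ => h2 ρ ys ω
      _ = ∑ ρ : List.Vector Bool (q.eval n), ∑ kl : (Fin (S.L n) → Yv S n) × List.Vector Bool (loLen S n), ∑ ω : List.Vector Bool κ,
            (if E (kl.1, (ρ, kl.2), ω) then (1 : ℝ) else 0) := by
          refine Finset.sum_congr rfl fun ρ _ => ?_
          rw [(KCL S n).sum_vector_eq (fun l => ∑ ω : List.Vector Bool κ, if E (((KCL S n).dec l).1, (ρ, ((KCL S n).dec l).2), ω) then (1 : ℝ) else 0)]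
          refine Finset.sum_congr rfl fun kl _ => ?_
          rw [(KCL S n).dec_enc]
      _ = ∑ z : (Fin (S.L n) → Yv S n) × (List.Vector Bool (q.eval n) × List.Vector Bool (loLen S n)) × List.Vector Bool κ, (if E z then (1 : ℝ) else 0) := by
          simp only [Fintype.sum_prod_type]
          rw [Finset.sum_comm]
      _ = C₀ := by rw [Finset.natCast_card_filter]
  -- Step 4: the union bound over `(i, b)` and planting
  have h4 : C₀ ≤ ∑ i : Fin (S.L n), ∑ b : Fin (BP.eval n),
      ((univ : Finset ((Fin (S.L n) → Yv S n) × (List.Vector Bool (q.eval n) × List.Vector Bool (loLen S n)) × List.Vector Bool κ)).filter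
        (LB S n (q.eval n) κ A₀ A i b)).card := by
    have hsub : (univ : Finset ((Fin (S.L n) → Yv S n) × (List.Vector Bool (q.eval n) × List.Vector Bool (loLen S n)) × List.Vector Bool κ)).filter E ⊆
        (univ : Finset (Fin (S.L n) × Fin (BP.eval n))).biUnion fun ib =>
          (univ : Finset ((Fin (S.L n) → Yv S n) × (List.Vector Bool (q.eval n) × List.Vector Bool (loLen S n)) × List.Vector Bool κ)).filter
            (LB S n (q.eval n) κ A₀ A ib.1 ib.2) := by
      intro z hz
      rw [Finset.mem_filter] at hz
      have hg := hgood z.2.1.1.toList z.2.1.1.toList_length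
      obtain ⟨i, b, hib⟩ := LB_of_Acoll hS hg.1 hg.2 hz.2
      rw [Finset.mem_biUnion]
      exact ⟨(i, b), Finset.mem_univ _, Finset.mem_filter.2 ⟨Finset.mem_univ _, hib⟩⟩
    refine (Finset.card_le_card hsub).trans (Finset.card_biUnion_le.trans ?_)
    rw [Fintype.sum_prod_type]
  have h4p : ∀ (i : Fin (S.L n)) (b : Fin (BP.eval n)),
      Fintype.card (Yv S n) * ((univ : Finset ((Fin (S.L n) → Yv S n) × (List.Vector Bool (q.eval n) × List.Vector Bool (loLen S n)) × List.Vector Bool κ)).filter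
        (LB S n (q.eval n) κ A₀ A i b)).card =
      ((univ : Finset (Yv S n × (Fin (S.L n) → Yv S n) × ((List.Vector Bool (q.eval n) × List.Vector Bool (loLen S n)) × List.Vector Bool κ))).filter fun z => LB S n (q.eval n) κ A₀ A i b (Function.update z.2.1 i z.1, z.2.2)).card := by
    intro i b
    rw [card_filter_plant i (fun keys w => LB S n (q.eval n) κ A₀ A i b (keys, w))]
  -- Step 5: `B`'s probability as a normalised count over `(r_B, y, ω)`
  let IB : List.Vector Bool (RBC S q BP n).len → Yv S n → List.Vector Bool κ → ℝ := fun rB y ω =>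
    if (base S).IsRestrictedCollision dB
        ((base S).index.run n y.toList, B0PT S q BP A₀ rB.toList,
          (redBT S q BP A).run (boolPair (unaryEncodeNat n) (boolPair ((base S).index.run n y.toList) rB.toList)) ω.toList) then 1 else 0
  have hrun1 : ∀ y : Yv S n, (base S).index.run n y.toList = ones n ++ false :: y.toList := fun y => pShaped_index_run _ _ _ _
  have hκB : ∀ (rB : List.Vector Bool (RBC S q BP n).len) (y : Yv S n),
      (redBT S q BP A).coinLen (boolPair (unaryEncodeNat n) (boolPair ((base S).index.run n y.toList) rB.toList)).length = κ := by
    intro rB y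
    rw [redBT_coinLen (A := A) n (by rw [hrun1]; simp [ones, LenPres.M]; ring) (by rw [List.Vector.toList_length, RBC_len hS])]
  have hmidB : (base S).index.coinLen (unaryEncodeNat n).length = S.P.eval n := by
    show S.P.eval (unaryEncodeNat n).length = _
    rw [unaryEncodeNat_eq_replicate, List.length_replicate]
  have h5 : (base S).rtcrProb dB (fun m => (QB S q BP + Polynomial.X + 1).eval m) (B0PT S q BP A₀) (redBT S q BP A) n =
      (∑ rB : List.Vector Bool (RBC S q BP n).len, ∑ y : Yv S n, ∑ ω : List.Vector Bool κ, IB rB y ω) /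
        (2 ^ (RBC S q BP n).len * 2 ^ S.P.eval n * 2 ^ κ) := by
    rw [HashCollection.rtcrProb_eq_uniformAvg, hmidB, QB_eval_eq, ← RBC_len (q := q) (BP := BP) hS, uniformAvg]
    have hrB : ∀ rB : List.Vector Bool (RBC S q BP n).len, uniformAvg (S.P.eval n) (fun rI => uniformAvg
        ((redBT S q BP A).coinLen (boolPair (unaryEncodeNat n) (boolPair ((base S).index.run n rI) rB.toList)).length)
        (fun rA => if (base S).IsRestrictedCollision dB
          ((base S).index.run n rI, B0PT S q BP A₀ rB.toList, (redBT S q BP A).run (boolPair (unaryEncodeNat n) (boolPair ((base S).index.run n rI) rB.toList)) rA)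
          then (1 : ℝ) else 0)) = (∑ y : Yv S n, (∑ ω : List.Vector Bool κ, IB rB y ω) / 2 ^ κ) / 2 ^ S.P.eval n := by
      intro rB
      rw [uniformAvg, Finset.sum_congr rfl fun y _ => by rw [hκB rB y, uniformAvg]]
    rw [Finset.sum_congr rfl fun rB _ => hrB rB]
    simp only [← Finset.sum_div]
    rw [div_div, div_div]
    refine congrArg₂ (· / ·) rfl ?_
    ring
  -- Step 6: planted level-block collisions are collisions of `B`
  have h6 : ∀ (i : Fin (S.L n)) (b : Fin (BP.eval n)),
      (((univ : Finset (Yv S n × (Fin (S.L n) → Yv S n) × ((List.Vector Bool (q.eval n) × List.Vector Bool (loLen S n)) × List.Vector Bool κ))).filter fun z => LB S n (q.eval n) κ A₀ A i b (Function.update z.2.1 i z.1, z.2.2)).card : ℝ) * Fintype.card (List.Vector Bool (jkLen S q BP n)) ≤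
        ∑ t : (List.Vector Bool (q.eval n) × (((Fin (S.L n) → Yv S n) × List.Vector Bool (loLen S n)) × List.Vector Bool (jkLen S q BP n))), ∑ y : Yv S n, ∑ ω : List.Vector Bool κ, IB ⟨(RBC S q BP n).enc ((ibOf S n i, bbOf BP n b), t), (RBC S q BP n).length_enc _⟩ y ω := by
    intro i b
    have hle : ∀ (t : (List.Vector Bool (q.eval n) × (((Fin (S.L n) → Yv S n) × List.Vector Bool (loLen S n)) × List.Vector Bool (jkLen S q BP n)))) (y : Yv S n) (ω : List.Vector Bool κ), (if LB S n (q.eval n) κ A₀ A i b (Function.update t.2.1.1 i y, ((t.1, t.2.1.2), ω)) then (1 : ℝ) else 0) ≤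
        IB ⟨(RBC S q BP n).enc ((ibOf S n i, bbOf BP n b), t), (RBC S q BP n).length_enc _⟩ y ω := by
      rintro ⟨ρ, ⟨keys, lo⟩, jk⟩ y ω
      refine ite_le_ite_of_imp fun hP => ?_
      simp only [List.Vector.toList_mk, hrun1]
      exact collision_of_LB hS hL (hdB n) i b y keys lo ρ jk ω (by simpa only using hP)
    have hsum : ∑ t : (List.Vector Bool (q.eval n) × (((Fin (S.L n) → Yv S n) × List.Vector Bool (loLen S n)) × List.Vector Bool (jkLen S q BP n))), ∑ y : Yv S n, ∑ ω : List.Vector Bool κ, (if LB S n (q.eval n) κ A₀ A i b (Function.update t.2.1.1 i y, ((t.1, t.2.1.2), ω)) then (1 : ℝ) else 0) =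
        (((univ : Finset (Yv S n × (Fin (S.L n) → Yv S n) × ((List.Vector Bool (q.eval n) × List.Vector Bool (loLen S n)) × List.Vector Bool κ))).filter fun z => LB S n (q.eval n) κ A₀ A i b (Function.update z.2.1 i z.1, z.2.2)).card : ℝ) * Fintype.card (List.Vector Bool (jkLen S q BP n)) := by
      rw [mul_comm, ← Fintype.sum_prod_type', ← Fintype.sum_prod_type',
        Fintype.sum_equiv (reixT S q BP n κ) _ (fun w => if LB S n (q.eval n) κ A₀ A i b (Function.update w.2.2.1 i w.2.1, w.2.2.2) then (1 : ℝ) else 0) (by rintro ⟨⟨⟨ρ, ⟨keys, lo⟩, jk⟩, y⟩, ω⟩; rfl)]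
      exact sum_ite_snd_eq (P := fun (z : (Yv S n × (Fin (S.L n) → Yv S n) × ((List.Vector Bool (q.eval n) × List.Vector Bool (loLen S n)) × List.Vector Bool κ))) => LB S n (q.eval n) κ A₀ A i b (Function.update z.2.1 i z.1, z.2.2))
    rw [← hsum]
    exact Finset.sum_le_sum fun t _ => Finset.sum_le_sum fun y _ => Finset.sum_le_sum fun ω _ => hle t y ω
  -- Step 7: summing the codes of `(i, b)` stays below the full sum
  have hcd : Function.Injective (fun ib : Fin (S.L n) × Fin (BP.eval n) => (ibOf S n ib.1, bbOf BP n ib.2)) := by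
    rintro ⟨i, b⟩ ⟨i', b'⟩ h
    simp only [Prod.mk.injEq] at h
    rw [ibOf_injective h.1, bbOf_injective h.2]
  have h7 : ∑ ib : Fin (S.L n) × Fin (BP.eval n), ∑ t : (List.Vector Bool (q.eval n) × (((Fin (S.L n) → Yv S n) × List.Vector Bool (loLen S n)) × List.Vector Bool (jkLen S q BP n))),
        ∑ y : Yv S n, ∑ ω : List.Vector Bool κ, IB ⟨(RBC S q BP n).enc ((ibOf S n ib.1, bbOf BP n ib.2), t), (RBC S q BP n).length_enc _⟩ y ω ≤
      ∑ rB : List.Vector Bool (RBC S q BP n).len, ∑ y : Yv S n, ∑ ω : List.Vector Bool κ, IB rB y ω := by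
    have hnn : ∀ rB y ω, 0 ≤ IB rB y ω := fun rB y ω => by simp only [IB]; split_ifs <;> norm_num
    conv_rhs => rw [(RBC S q BP n).sum_vector_eq (fun l => ∑ y : Yv S n, ∑ ω : List.Vector Bool κ,
      if (base S).IsRestrictedCollision dB ((base S).index.run n y.toList, B0PT S q BP A₀ l,
        (redBT S q BP A).run (boolPair (unaryEncodeNat n) (boolPair ((base S).index.run n y.toList) l)) ω.toList) then (1 : ℝ) else 0),
      Fintype.sum_prod_type]
    calc ∑ ib : Fin (S.L n) × Fin (BP.eval n), ∑ t : (List.Vector Bool (q.eval n) × (((Fin (S.L n) → Yv S n) × List.Vector Bool (loLen S n)) × List.Vector Bool (jkLen S q BP n))), ∑ y : Yv S n, ∑ ω : List.Vector Bool κ,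
          IB ⟨(RBC S q BP n).enc ((ibOf S n ib.1, bbOf BP n ib.2), t), (RBC S q BP n).length_enc _⟩ y ω
        = ∑ cd ∈ (univ : Finset (Fin (S.L n) × Fin (BP.eval n))).image (fun ib => (ibOf S n ib.1, bbOf BP n ib.2)), ∑ t : (List.Vector Bool (q.eval n) × (((Fin (S.L n) → Yv S n) × List.Vector Bool (loLen S n)) × List.Vector Bool (jkLen S q BP n))),
            ∑ y : Yv S n, ∑ ω : List.Vector Bool κ, IB ⟨(RBC S q BP n).enc (cd, t), (RBC S q BP n).length_enc _⟩ y ω := by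
          rw [Finset.sum_image fun ib _ ib' _ h => hcd h]
      _ ≤ ∑ cd : List.Vector Bool (aLb S n) × List.Vector Bool (aBb BP n), ∑ t : (List.Vector Bool (q.eval n) × (((Fin (S.L n) → Yv S n) × List.Vector Bool (loLen S n)) × List.Vector Bool (jkLen S q BP n))),
            ∑ y : Yv S n, ∑ ω : List.Vector Bool κ, IB ⟨(RBC S q BP n).enc (cd, t), (RBC S q BP n).length_enc _⟩ y ω :=
          Finset.sum_le_sum_of_subset_of_nonneg (Finset.subset_univ _) fun cd _ _ =>
            Finset.sum_nonneg fun t _ => Finset.sum_nonneg fun y _ => Finset.sum_nonneg fun ω _ => hnn _ _ _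
      _ = _ := Finset.sum_congr rfl fun cd _ => Finset.sum_congr rfl fun t _ => rfl
  -- Step 8: assemble with the cardinalities
  have hY : (Fintype.card (Yv S n) : ℝ) = 2 ^ S.P.eval n := by rw [card_vector, Fintype.card_bool]; push_cast; ring
  have hJ : (Fintype.card (List.Vector Bool (jkLen S q BP n)) : ℝ) = 2 ^ jkLen S q BP n := by rw [card_vector, Fintype.card_bool]; push_cast; ring
  have hRBC : (2 : ℝ) ^ (RBC S q BP n).len = 2 ^ (aLb S n + aBb BP n) * (2 ^ q.eval n * 2 ^ (KCL S n).len * 2 ^ jkLen S q BP n) := by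
    rw [show (RBC S q BP n).len = (aLb S n + aBb BP n) + (q.eval n + ((KCL S n).len + jkLen S q BP n)) from rfl]; simp only [pow_add]; ring
  have hY0 : (0 : ℝ) < 2 ^ S.P.eval n := by positivity
  have hJ0 : (0 : ℝ) < 2 ^ jkLen S q BP n := by positivity
  have hA : (∑ ρ : List.Vector Bool (q.eval n), ∑ ys : List.Vector Bool (KCL S n).len, ∑ ω : List.Vector Bool κ, IS ρ ys ω) * (2 ^ S.P.eval n * 2 ^ jkLen S q BP n) ≤
      ∑ rB : List.Vector Bool (RBC S q BP n).len, ∑ y : Yv S n, ∑ ω : List.Vector Bool κ, IB rB y ω := by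
    have h4R : (C₀ : ℝ) * 2 ^ S.P.eval n ≤ ∑ i : Fin (S.L n), ∑ b : Fin (BP.eval n), (((univ : Finset (Yv S n × (Fin (S.L n) → Yv S n) × ((List.Vector Bool (q.eval n) × List.Vector Bool (loLen S n)) × List.Vector Bool κ))).filter fun z => LB S n (q.eval n) κ A₀ A i b (Function.update z.2.1 i z.1, z.2.2)).card : ℝ) := by
      have := h4
      have e : ∀ (i : Fin (S.L n)) (b : Fin (BP.eval n)), ((((univ : Finset ((Fin (S.L n) → Yv S n) × (List.Vector Bool (q.eval n) × List.Vector Bool (loLen S n)) × List.Vector Bool κ)).filter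
          (LB S n (q.eval n) κ A₀ A i b)).card : ℝ) * 2 ^ S.P.eval n) = (((univ : Finset (Yv S n × (Fin (S.L n) → Yv S n) × ((List.Vector Bool (q.eval n) × List.Vector Bool (loLen S n)) × List.Vector Bool κ))).filter fun z => LB S n (q.eval n) κ A₀ A i b (Function.update z.2.1 i z.1, z.2.2)).card : ℝ) := by
        intro i b; rw [← hY, mul_comm]; exact_mod_cast h4p i b
      calc (C₀ : ℝ) * 2 ^ S.P.eval n ≤ (∑ i : Fin (S.L n), ∑ b : Fin (BP.eval n),
            (((univ : Finset ((Fin (S.L n) → Yv S n) × (List.Vector Bool (q.eval n) × List.Vector Bool (loLen S n)) × List.Vector Bool κ)).filter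
              (LB S n (q.eval n) κ A₀ A i b)).card : ℝ)) * 2 ^ S.P.eval n := by
              refine mul_le_mul_of_nonneg_right ?_ hY0.le; exact_mod_cast this
        _ = _ := by rw [Finset.sum_mul]; refine Finset.sum_congr rfl fun i _ => ?_; rw [Finset.sum_mul]; exact Finset.sum_congr rfl fun b _ => e i b
    calc (∑ ρ : List.Vector Bool (q.eval n), ∑ ys : List.Vector Bool (KCL S n).len, ∑ ω : List.Vector Bool κ, IS ρ ys ω) * (2 ^ S.P.eval n * 2 ^ jkLen S q BP n)
        ≤ (C₀ : ℝ) * 2 ^ S.P.eval n * 2 ^ jkLen S q BP n := by rw [← mul_assoc]; exact mul_le_mul_of_nonneg_right (mul_le_mul_of_nonneg_right h3 hY0.le) hJ0.le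
      _ ≤ (∑ i : Fin (S.L n), ∑ b : Fin (BP.eval n), (((univ : Finset (Yv S n × (Fin (S.L n) → Yv S n) × ((List.Vector Bool (q.eval n) × List.Vector Bool (loLen S n)) × List.Vector Bool κ))).filter fun z => LB S n (q.eval n) κ A₀ A i b (Function.update z.2.1 i z.1, z.2.2)).card : ℝ)) * 2 ^ jkLen S q BP n :=
          mul_le_mul_of_nonneg_right h4R hJ0.le
      _ = ∑ i : Fin (S.L n), ∑ b : Fin (BP.eval n), (((univ : Finset (Yv S n × (Fin (S.L n) → Yv S n) × ((List.Vector Bool (q.eval n) × List.Vector Bool (loLen S n)) × List.Vector Bool κ))).filter fun z => LB S n (q.eval n) κ A₀ A i b (Function.update z.2.1 i z.1, z.2.2)).card : ℝ) * Fintype.card (List.Vector Bool (jkLen S q BP n)) := by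
          rw [hJ, Finset.sum_mul]; refine Finset.sum_congr rfl fun i _ => ?_; rw [Finset.sum_mul]
      _ ≤ ∑ i : Fin (S.L n), ∑ b : Fin (BP.eval n), ∑ t : (List.Vector Bool (q.eval n) × (((Fin (S.L n) → Yv S n) × List.Vector Bool (loLen S n)) × List.Vector Bool (jkLen S q BP n))), ∑ y : Yv S n, ∑ ω : List.Vector Bool κ,
            IB ⟨(RBC S q BP n).enc ((ibOf S n i, bbOf BP n b), t), (RBC S q BP n).length_enc _⟩ y ω :=
          Finset.sum_le_sum fun i _ => Finset.sum_le_sum fun b _ => h6 i b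
      _ = ∑ ib : Fin (S.L n) × Fin (BP.eval n), ∑ t : (List.Vector Bool (q.eval n) × (((Fin (S.L n) → Yv S n) × List.Vector Bool (loLen S n)) × List.Vector Bool (jkLen S q BP n))), ∑ y : Yv S n, ∑ ω : List.Vector Bool κ,
            IB ⟨(RBC S q BP n).enc ((ibOf S n ib.1, bbOf BP n ib.2), t), (RBC S q BP n).length_enc _⟩ y ω :=
          (Fintype.sum_prod_type' (f := fun (i : Fin (S.L n)) (b : Fin (BP.eval n)) => ∑ t : (List.Vector Bool (q.eval n) × (((Fin (S.L n) → Yv S n) × List.Vector Bool (loLen S n)) × List.Vector Bool (jkLen S q BP n))), ∑ y : Yv S n, ∑ ω : List.Vector Bool κ,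
            IB ⟨(RBC S q BP n).enc ((ibOf S n i, bbOf BP n b), t), (RBC S q BP n).length_enc _⟩ y ω)).symm
      _ ≤ _ := h7
  rw [h1, h5, div_le_iff₀ (by positivity)]
  have key : ∀ {X Y a b c p j A2 : ℝ}, 0 < A2 → 0 < p → 0 < j → 0 < a → 0 < b → 0 < c → X * (p * j) ≤ Y →
      X ≤ A2 * (Y / (A2 * (a * b * j) * p * c)) * (a * b * c) := by
    intro X Y a b c p j A2 hA2 hp hj ha hb hc h
    have : A2 * (Y / (A2 * (a * b * j) * p * c)) * (a * b * c) = Y / (p * j) := by field_simp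
    rw [this, le_div_iff₀ (mul_pos hp hj)]; exact h
  have hX := key (X := ∑ ρ : List.Vector Bool (q.eval n), ∑ ys : List.Vector Bool (KCL S n).len, ∑ ω : List.Vector Bool κ, IS ρ ys ω)
    (by positivity : (0 : ℝ) < (2 : ℝ) ^ (aLb S n + aBb BP n)) hY0 hJ0 (by positivity : (0:ℝ) < 2 ^ q.eval n) (by positivity : (0:ℝ) < 2 ^ (KCL S n).len)
    (by positivity : (0:ℝ) < 2 ^ κ) hA
  rw [hRBC]
  exact hX

end Count

/-! ### Asymptotics -/

section Asymptotic

variable {S : TSpec}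

/-- A polynomial (plus a constant) is eventually below `2ⁿ`. [folklore] -/
theorem eventually_eval_add_le_two_pow (p : Polynomial ℕ) (c : ℕ) : ∀ᶠ n : ℕ in atTop, p.eval n + c ≤ 2 ^ n := by
  obtain ⟨a, k, hak⟩ := exists_eval_le_mul_pow_add p
  -- `(a n^k + a + c) / 2^n → 0`
  have h1 : Tendsto (fun n : ℕ => ((a : ℝ) * (n : ℝ) ^ k + (a + c)) / (2 : ℝ) ^ n) atTop (nhds 0) := by
    have ha : Tendsto (fun n : ℕ => (a : ℝ) * ((n : ℝ) ^ k / (2 : ℝ) ^ n)) atTop (nhds 0) := by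
      simpa using (tendsto_pow_const_div_const_pow_of_one_lt k (one_lt_two : (1 : ℝ) < 2)).const_mul (a : ℝ)
    have hb : Tendsto (fun n : ℕ => ((a : ℝ) + c) / (2 : ℝ) ^ n) atTop (nhds 0) :=
      tendsto_const_nhds.div_atTop (tendsto_pow_atTop_atTop_of_one_lt one_lt_two)
    have hab := ha.add hb
    rw [add_zero] at hab
    refine hab.congr fun n => ?_
    ring
  have h2 := h1.eventually (gt_mem_nhds zero_lt_one)
  filter_upwards [h2] with n hn
  have hpos : (0 : ℝ) < (2 : ℝ) ^ n := by positivity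
  rw [div_lt_one hpos] at hn
  have h3 : ((p.eval n + c : ℕ) : ℝ) < (2 : ℝ) ^ n := by
    have h4 : ((p.eval n : ℕ) : ℝ) ≤ (a : ℝ) * (n : ℝ) ^ k + a := by exact_mod_cast hak n
    push_cast
    linarith
  exact_mod_cast h3.le

/-- **Targets of a polynomial-time first stage are eventually in range and short.** With `L(n) ≥ n` levels and an output
bound `|A₀ r| ≤ P_A(|r|)`: eventually every `r ∈ {0,1}^{q(n)}` has `depth(A₀ r) ≤ L(n)` and `|A₀ r| + 1 ≤ (P_A ∘ q + 1)(n)`.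
[cite: Goldreich2004, Construction 6.4.26 (inputs of length at most `2ⁿ`)] -/
theorem eventually_good (hS : S.WF) (hLn : ∀ n, n ≤ S.L n) (q PA : Polynomial ℕ) {A₀ : List Bool → List Bool}
    (hPA : ∀ x, (A₀ x).length ≤ PA.eval x.length) :
    ∀ᶠ n : ℕ in atTop, 1 ≤ S.L n ∧ ∀ r : List Bool, r.length = q.eval n →
      dep S n (A₀ r) ≤ S.L n ∧ (A₀ r).length + 1 ≤ (PA.comp q + 1).eval n := by
  filter_upwards [eventually_eval_add_le_two_pow (PA.comp q) 1, eventually_ge_atTop 1] with n hn hn1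
  refine ⟨hn1.trans (hLn n), fun r hr => ⟨?_, ?_⟩⟩
  · refine depth_le_of_le (hS.one_le_m n) ?_
    have h1 : (A₀ r).length ≤ (PA.comp q).eval n := by rw [eval_comp, ← hr]; exact hPA r
    have h2 : 2 ^ n ≤ S.m n * 2 ^ S.L n :=
      le_trans (Nat.pow_le_pow_right (by norm_num) (hLn n)) (Nat.le_mul_of_pos_left _ (hS.one_le_m n))
    omega
  · rw [eval_add, eval_one, eval_comp, ← hr]; exact Nat.add_le_add_right (hPA r) 1

/-- `2^{|bin L| + |bin B_P|} ≤ (2 P_L + 1)(2 B_P + 1)`, a polynomial. [folklore] -/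
theorem two_pow_codes_le (hS : S.WF) (BP : Polynomial ℕ) (n : ℕ) :
    2 ^ (aLb S n + aBb BP n) ≤ ((C 2 * S.PL + 1) * (C 2 * BP + 1)).eval n := by
  have h1 : 2 ^ aLb S n ≤ 2 * S.L n + 1 := UExpr.pow2_le (fun _ => S.L n) (UExpr.var 0)
  have h2 : 2 ^ aBb BP n ≤ 2 * BP.eval n + 1 := UExpr.pow2_le (fun _ => BP.eval n) (UExpr.var 0)
  have h3 := hS.L_le n
  rw [pow_add, eval_mul]
  refine Nat.mul_le_mul (h1.trans ?_) (h2.trans ?_)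
  · simp only [eval_add, eval_mul, eval_C, eval_one]; omega
  · simp only [eval_add, eval_mul, eval_C, eval_one]; omega

/-- **Negligibility transfers through the tree** (Props. 6.4.25 + 6.4.27): if every two-stage PPT adversary has negligible
restricted designated-collision probability against `base S` (domain `{0,1}^{2m}`), then every two-stage PPT adversary
has negligible designated-collision probability against `treeHash S`. [cite: Goldreich2004, Props. 6.4.25, 6.4.27] -/
theorem superpolynomialDecay_tcrProb_tree (hS : S.WF) (hLn : ∀ n, n ≤ S.L n) {dB : ℕ → ℕ} (hdB : ∀ n, dB (LenPres.M S.P n) = 2 * S.m n)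
    (hbase : ∀ q' : Polynomial ℕ, ∀ B₀ : List Bool → List Bool, B₀ ∈ FP → ∀ B : RandAlg (List Bool) (List Bool), IsPPT B id →
      SuperpolynomialDecay atTop (fun n : ℕ => (n : ℝ)) ((base S).rtcrProb dB (fun m => q'.eval m) B₀ B))
    (q : Polynomial ℕ) {A₀ : List Bool → List Bool} (hA₀ : A₀ ∈ FP) {A : RandAlg (List Bool) (List Bool)} (hA : IsPPT A id) :
    SuperpolynomialDecay atTop (fun n : ℕ => (n : ℝ)) ((treeHash S).tcrProb (fun m => q.eval m) A₀ A) := by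
  obtain ⟨PA, hPA⟩ := exists_poly_length_le_of_mem_FP hA₀
  set BP : Polynomial ℕ := PA.comp q + 1 with hBP
  have hneg := hbase (QB S q BP + Polynomial.X + 1) (B0PT S q BP A₀) (B0PT_mem_FP hS hA₀) (redBT S q BP A) (isPPT_redBT hS hA)
  have hpoly : SuperpolynomialDecay atTop (fun n : ℕ => (n : ℝ))
      (fun n => ((((C 2 * S.PL + 1) * (C 2 * BP + 1)).eval n : ℕ) : ℝ) *
        (base S).rtcrProb dB (fun m => (QB S q BP + Polynomial.X + 1).eval m) (B0PT S q BP A₀) (redBT S q BP A) n) := by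
    refine (hneg.polynomial_mul (((C 2 * S.PL + 1) * (C 2 * BP + 1)).map (Nat.castRingHom ℝ))).congr fun n => ?_
    rw [Polynomial.eval_map, Polynomial.eval₂_at_natCast]
    simp only [eq_natCast, Nat.cast_id]
  refine hpoly.trans_eventually_abs_le ?_
  filter_upwards [eventually_good hS hLn q PA hPA] with n hn
  have h0 := HashCollection.rtcrProb_nonneg (base S) dB (fun m => (QB S q BP + Polynomial.X + 1).eval m) (B0PT S q BP A₀) (redBT S q BP A) n
  simp only [Function.comp_apply]
  rw [abs_of_nonneg (HashCollection.tcrProb_nonneg _ _ _ _ _), abs_of_nonneg (mul_nonneg (Nat.cast_nonneg _) h0)]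
  refine (tcrProb_tree_le hS hdB n hn.1 hn.2).trans (mul_le_mul_of_nonneg_right ?_ h0)
  exact_mod_cast two_pow_codes_le hS BP n

/-- **The tree hashing of a leveled restricted halving UOWHF is target-collision resistant against every two-stage PPT
adversary, on unrestricted inputs** (Goldreich's Steps III–IV, Props. 6.4.25 and 6.4.27, for our leveled families): efficiency,
range `rLenT` on all inputs, and negligible designated-collision probability. The renormalisation of the index length to
`|s| = n` (Def. 6.4.18 (1)) is a separate, final step. [cite: Goldreich2004, Props. 6.4.25, 6.4.27; Def. 6.4.18] -/
theorem tcr_treeHash (hS : S.WF) (hLn : ∀ n, n ≤ S.L n) {dB rB : ℕ → ℕ} (hdB : ∀ n, dB (LenPres.M S.P n) = 2 * S.m n)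
    (hbase : (base S).IsLeveledRUOWHF dB rB) :
    (treeHash S).IsEfficient ∧ (treeHash S).HasRange (rLenT S) ∧
      ∀ q : Polynomial ℕ, ∀ A₀ : List Bool → List Bool, A₀ ∈ FP → ∀ A : RandAlg (List Bool) (List Bool), IsPPT A id →
        SuperpolynomialDecay atTop (fun n : ℕ => (n : ℝ)) ((treeHash S).tcrProb (fun m => q.eval m) A₀ A) :=
  ⟨isEfficient_treeHash hS, hasRange_treeHash hS, fun q _ hA₀ _ hA => superpolynomialDecay_tcrProb_tree hS hLn hdB hbase.2.2 q hA₀ hA⟩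

end Asymptotic

end TreeHash

end Literature.Computability.Cryptography
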